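import Summits.FinalStateConjecture.FinalStateConjecture.Theorems.EIHFluxBalanceInertialRecessionStubQuasiStationarityWeights
import Summits.FinalStateConjecture.FinalStateConjecture.Theorems.EIHFluxBalanceInertialRecessionStubWeightedRatesNecessityRate

/-!
# Route EIHFluxBalance — `InertialRecession`, line `sublinear-is-free-clean-window-charges`,
# stub `stub_weightedRates`: QS ⇒ weighted 4-velocity rate (the dynamical input is necessary)

Helper file of the worker on `stub_weightedRates` (crux `stmt-FinalStateConjecture-10166`), last of
the necessity chain `…StubWeightedRatesNecessity` (closed form of `∂₀S(x)(u, u)`),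
`…StubWeightedRatesNecessityRate` (lower bound, alignment: the kernel `M/d` is attained).

* `weightedRate_e0_of_quasiStationarity` — for ONE painted Schwarzschild hole with the crux kinematics
  (Lorentz factor `≤ γ`, centre eventually in the inner cone `‖ξ(t)‖ ≤ κ²t`, eventually bounded
  drift) the quasi-stationarity clause QS of the line — read with the single exclusion radius
  `ρ(t) = ct`, `c = (κ − κ²)/2` — implies the weighted 4-velocity rate `t^{3/4}‖(Λe₀)˙(t)‖ → 0`.

So RATES_E0, the dynamical input of `…StubWeightedRatesReductionE0.stub_quasiStationarity_of_weightedRates_e0`,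
is not only sufficient but NECESSARY for QS: no weaker hypothesis on the painted 4-velocities can
replace it in the reduction (numbers: at `d ≍ t` the weight `d^{7/4}` against the attained kernel
`M‖u̇‖/d` leaves exactly `t^{3/4}‖u̇‖`).
-/

set_option linter.dupNamespace false

noncomputable section

namespace Summit.FinalStateConjecture.FinalStateConjecture.Theorems.SublinearIsFree.WeightedRates

open scoped BigOperators Topology ContDiff InnerProductSpace ENNReal
open Filter Set Function Literature.Geometry.Lorentzian
open Summit.FinalStateConjecture.FinalStateConjecture.Theorems
open Summit.FinalStateConjecture.FinalStateConjecture.Theorems.InertialRecession.Negative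
open Summit.FinalStateConjecture.FinalStateConjecture.Theorems.SublinearIsFree.QuasiStationarity

/-! ### Quasi-stationarity forces the weighted 4-velocity rate -/

/-- `ofReal w · ‖V‖ₑ = ofReal (w ‖V‖)` for `w ≥ 0`. [folklore] -/
theorem wr_ofReal_mul_enorm {F : Type*} [SeminormedAddCommGroup F] {w : ℝ} (hw : 0 ≤ w) (V : F) :
    ENNReal.ofReal w * ‖V‖ₑ = ENNReal.ofReal (w * ‖V‖) := by
  rw [ENNReal.ofReal_mul hw, ofReal_norm]

/-- Fourth root of a fourth power. [folklore] -/
theorem wr_sqrt_sqrt_pow_four {s : ℝ} (hs : 0 ≤ s) : √(√(s ^ 4)) = s := by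
  rw [show s ^ 4 = (s ^ 2) ^ 2 by ring, Real.sqrt_sq (by positivity), Real.sqrt_sq hs]

-- operator-norm instance paths on form-valued maps are slow to unify
set_option synthInstance.maxHeartbeats 200000 in
set_option maxHeartbeats 1600000 in
/-- **Quasi-stationarity forces the weighted 4-velocity rate (one Schwarzschild hole).** For one
painted Schwarzschild summand (`M ≠ 0`, `a = 0`) with `C¹` moduli, Lorentz factor `≤ γ`, centre
eventually in the inner cone `‖ξ(t)‖ ≤ κ²t` (`0 < κ < 1`) and eventually bounded drift: if the
quasi-stationarity clause QS of the line holds — for EVERY exclusion radius `ρ(t) → ∞`, the weighted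
sup of `‖D S(x)[e₀]‖` over the slab points of the cone `|x̲| ≤ κt` at distance `≥ ρ(t)` from the
centre tends to `0` — then `t^{3/4}‖(Λe₀)˙(t)‖ → 0`. Proof: read QS with `ρ(t) = ct`,
`c = (κ − κ²)/2`, at the aligned point of `exists_direction_norm_fderiv_summand_ge` at distance
`d = ct`: `(1 + d^{7/4})(2|M|‖Λ̇e₀‖/(G⁴d) − 2|M|V/(Gd²)) ≤ η'` gives
`t^{3/4}‖Λ̇e₀‖ ≤ c^{-3/4}(G⁴η'/(2|M|) + 2G³V d^{-1/4})`. So RATES_E0 is NECESSARY for QS. [folklore] -/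
theorem weightedRate_e0_of_quasiStationarity {M γ κ V : ℝ} {Λ : ℝ → lorentzGroup} {ξ : ℝ → E3}
    (hM : M ≠ 0) (hΛ : ContDiff ℝ 1 (fun s ↦ ((Λ s : E4 ≃L[ℝ] E4) : E4 →L[ℝ] E4)))
    (hξ : ContDiff ℝ 1 ξ) (hγ : ∀ t, |((Λ t : E4 ≃L[ℝ] E4) (E4.basisVector 0)) 0| ≤ γ)
    (hκ : 0 < κ ∧ κ < 1) (hcone : ∀ᶠ t in atTop, ‖ξ t‖ ≤ κ ^ 2 * t)
    (hV : ∀ᶠ t in atTop, ‖deriv ξ t‖ ≤ V)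
    (hQS : ∀ ρ : ℝ → ℝ, Tendsto ρ atTop atTop →
      Tendsto (fun t : ℝ ↦ ⨆ x ∈ {x : E4 | x 0 = t ∧ E4.spatialNorm x ≤ κ * t ∧
          ρ t ≤ ‖E4.spatial x - ξ t‖},
        ENNReal.ofReal (1 + √(√(‖E4.spatial x - ξ t‖ ^ 7))) *
          ‖fderiv ℝ (fun y : E4 ↦ boostedKerrBilin (Λ (y 0)) (E4.ofTimeSpace (y 0) (ξ (y 0))) M 0 y -
            Minkowski.bilin) x (E4.basisVector 0)‖ₑ) atTop (𝓝 0)) :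
    Tendsto (fun t : ℝ ↦ t ^ (3 / 4 : ℝ) *
      ‖deriv (fun s ↦ (Λ s : E4 ≃L[ℝ] E4) (E4.basisVector 0)) t‖) atTop (𝓝 0) := by
  -- constants
  have hγ1 : 1 ≤ γ := (one_le_abs_lorentz_apply_zero (Λ 0)).trans (hγ 0)
  obtain ⟨G, hG⟩ : ∃ G : ℝ, G = 1 + 3 * γ := ⟨_, rfl⟩
  have hG1 : 1 ≤ G := by rw [hG]; linarith
  have hG0 : 0 < G := one_pos.trans_le hG1
  obtain ⟨c, hc⟩ : ∃ c : ℝ, c = (κ - κ ^ 2) / 2 := ⟨_, rfl⟩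
  have hκκ : κ ^ 2 < κ := by nlinarith [hκ.1, hκ.2]
  have hc0 : 0 < c := by rw [hc]; linarith
  have hM0 : 0 < |M| := abs_pos.mpr hM
  have hc34 : 0 < c ^ (3 / 4 : ℝ) := Real.rpow_pos_of_pos hc0 _
  obtain ⟨Vp, hVp⟩ : ∃ Vp : ℝ, Vp = max V 0 := ⟨_, rfl⟩
  have hVp0 : 0 ≤ Vp := by rw [hVp]; exact le_max_right _ _
  have hsup := hQS (fun t ↦ c * t) (tendsto_id.const_mul_atTop hc0)
  rw [Metric.tendsto_nhds]
  intro ε hε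
  -- thresholds
  obtain ⟨η', hη'⟩ : ∃ η' : ℝ, η' = ε * |M| * c ^ (3 / 4 : ℝ) / (2 * G ^ 4) := ⟨_, rfl⟩
  have hη'0 : 0 < η' := by rw [hη']; positivity
  obtain ⟨s₀, hs₀⟩ : ∃ s₀ : ℝ, s₀ = 8 * G ^ 3 * Vp / (ε * c ^ (3 / 4 : ℝ)) + 1 := ⟨_, rfl⟩
  have hs₀0 : 0 < s₀ := by rw [hs₀]; positivity
  have hev1 : ∀ᶠ t in atTop, (⨆ x ∈ {x : E4 | x 0 = t ∧ E4.spatialNorm x ≤ κ * t ∧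
      c * t ≤ ‖E4.spatial x - ξ t‖},
      ENNReal.ofReal (1 + √(√(‖E4.spatial x - ξ t‖ ^ 7))) *
        ‖fderiv ℝ (fun y : E4 ↦ boostedKerrBilin (Λ (y 0)) (E4.ofTimeSpace (y 0) (ξ (y 0))) M 0 y -
          Minkowski.bilin) x (E4.basisVector 0)‖ₑ) ≤ ENNReal.ofReal η' :=
    ENNReal.tendsto_nhds_zero.mp hsup _ (ENNReal.ofReal_pos.mpr hη'0)
  filter_upwards [hev1, hcone, hV, eventually_ge_atTop (1 : ℝ), eventually_ge_atTop (1 / c),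
    eventually_ge_atTop (s₀ ^ 4 / c)] with t h1 h2 h3 h4 h5 h6
  have ht0 : 0 < t := one_pos.trans_le h4
  obtain ⟨d, hdct⟩ : ∃ d : ℝ, d = c * t := ⟨_, rfl⟩
  have hd1 : 1 ≤ d := by
    rw [hdct]; have := (div_le_iff₀ hc0).mp h5; linarith
  have hd0 : 0 < d := one_pos.trans_le hd1
  have hds₀ : s₀ ^ 4 ≤ d := by
    rw [hdct]; have := (div_le_iff₀ hc0).mp h6; linarith
  -- the aligned point at distance `d`
  obtain ⟨w, hw, hlow⟩ := exists_direction_norm_fderiv_summand_ge M γ hΛ hξ (hγ t) hd1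
  have hsw : ‖E4.spatial (E4.ofTimeSpace t (ξ t + w)) - ξ t‖ = d := by simp [hw]
  have hxmem : E4.ofTimeSpace t (ξ t + w) ∈ {x : E4 | x 0 = t ∧ E4.spatialNorm x ≤ κ * t ∧
      c * t ≤ ‖E4.spatial x - ξ t‖} := by
    refine ⟨by simp, ?_, by rw [hsw, hdct]⟩
    rw [E4.spatialNorm_ofTimeSpace]
    refine (norm_add_le _ _).trans ?_
    rw [hw, hdct, hc]
    nlinarith [h2, ht0]
  have hpt := (le_iSup₂_of_le (f := fun (x : E4) (_ : x ∈ {x : E4 | x 0 = t ∧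
      E4.spatialNorm x ≤ κ * t ∧ c * t ≤ ‖E4.spatial x - ξ t‖}) ↦
      ENNReal.ofReal (1 + √(√(‖E4.spatial x - ξ t‖ ^ 7))) *
        ‖fderiv ℝ (fun y : E4 ↦ boostedKerrBilin (Λ (y 0)) (E4.ofTimeSpace (y 0) (ξ (y 0))) M 0 y -
          Minkowski.bilin) x (E4.basisVector 0)‖ₑ) (E4.ofTimeSpace t (ξ t + w)) hxmem le_rfl).trans h1
  simp only at hpt
  rw [wr_ofReal_mul_enorm (by positivity), ENNReal.ofReal_le_ofReal_iff hη'0.le, hsw] at hpt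
  -- fourth roots
  obtain ⟨hs0, hs4, hs7⟩ := fourthRoot_props hd0.le
  obtain ⟨s, hs⟩ : ∃ s : ℝ, s = √(√d) := ⟨_, rfl⟩
  rw [← hs] at hs0 hs4 hs7
  rw [hs7] at hpt
  have hs1 : 1 ≤ s := by
    by_contra h
    have h' : s < 1 := lt_of_not_ge h
    have : s ^ 4 < 1 := pow_lt_one₀ hs0 h' (by norm_num)
    linarith
  have hspos : 0 < s := one_pos.trans_le hs1
  have hss₀ : s₀ ≤ s := by
    have h : s₀ ^ 4 ≤ s ^ 4 := by rw [hs4]; exact hds₀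
    exact (pow_le_pow_iff_left₀ hs₀0.le hs0 (by norm_num)).mp h
  -- the lower bound at the aligned point, with the drift bound `Vp`
  obtain ⟨r, hr⟩ : ∃ r : ℝ, r = ‖deriv (fun s ↦ ((Λ s : E4 ≃L[ℝ] E4) : E4 →L[ℝ] E4)) t
      (E4.basisVector 0)‖ := ⟨_, rfl⟩
  have hr0 : 0 ≤ r := by rw [hr]; positivity
  obtain ⟨F, hF⟩ : ∃ F : ℝ, F = ‖fderiv ℝ (fun y : E4 ↦ boostedKerrBilin (Λ (y 0))
      (E4.ofTimeSpace (y 0) (ξ (y 0))) M 0 y - Minkowski.bilin) (E4.ofTimeSpace t (ξ t + w))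
      (E4.basisVector 0)‖ := ⟨_, rfl⟩
  have hF0 : 0 ≤ F := by rw [hF]; positivity
  rw [← hr, ← hG, ← hF] at hlow
  rw [← hF] at hpt
  have hVt : ‖deriv ξ t‖ ≤ Vp := h3.trans (by rw [hVp]; exact le_max_left _ _)
  have hlow' : 2 * |M| * r / (G ^ 4 * d) - 2 * |M| * Vp / (G * d ^ 2) ≤ F := by
    have h : 2 * |M| * ‖deriv ξ t‖ / (G * d ^ 2) ≤ 2 * |M| * Vp / (G * d ^ 2) := by gcongr
    linarith
  -- combine: `2|M| r s³/G⁴ ≤ η' + 4|M|Vp/(G s)`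
  obtain ⟨P, hP⟩ : ∃ P : ℝ, P = 2 * |M| * r / (G ^ 4 * d) := ⟨_, rfl⟩
  obtain ⟨Q, hQ⟩ : ∃ Q : ℝ, Q = 2 * |M| * Vp / (G * d ^ 2) := ⟨_, rfl⟩
  have hP0 : 0 ≤ P := by rw [hP]; positivity
  have hQ0 : 0 ≤ Q := by rw [hQ]; positivity
  rw [← hP, ← hQ] at hlow'
  have h7 : 1 ≤ s ^ 7 := one_le_pow₀ hs1
  have hw0 : 0 ≤ 1 + s ^ 7 := by positivity
  have hcomb : (1 + s ^ 7) * (P - Q) ≤ η' := (mul_le_mul_of_nonneg_left hlow' hw0).trans hpt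
  have hkey : s ^ 7 * P ≤ η' + 2 * s ^ 7 * Q := by
    nlinarith [mul_nonneg (sub_nonneg.mpr h7) hQ0, hP0, hQ0, hcomb]
  have e1 : s ^ 7 * P = 2 * |M| * r * s ^ 3 / G ^ 4 := by
    rw [hP, ← hs4]; field_simp
  have e2 : 2 * s ^ 7 * Q = 4 * |M| * Vp / (G * s) := by
    rw [hQ, ← hs4]; field_simp; ring
  rw [e1, e2] at hkey
  -- `t^{3/4} = s³ / c^{3/4}`
  have ht34 : t ^ (3 / 4 : ℝ) = s ^ 3 / c ^ (3 / 4 : ℝ) := by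
    have htd : t = s ^ 4 / c := by rw [hs4, hdct]; field_simp
    rw [htd, Real.div_rpow (by positivity) hc0.le, rpow_three_quarters_eq (by positivity),
      wr_sqrt_sqrt_pow_four hs0]
  -- conclude
  rw [Real.dist_eq, sub_zero, deriv_lorentz_apply_basisVector
    ((hΛ.differentiable one_ne_zero t).hasDerivAt) 0, ← hr, ht34,
    abs_of_nonneg (by positivity)]
  have hA : s ^ 3 * r ≤ G ^ 4 / (2 * |M|) * η' + 2 * G ^ 3 * Vp / s := by
    have h := mul_le_mul_of_nonneg_left hkey (by positivity : 0 ≤ G ^ 4 / (2 * |M|))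
    have e3 : G ^ 4 / (2 * |M|) * (2 * |M| * r * s ^ 3 / G ^ 4) = s ^ 3 * r := by
      field_simp
    have e4 : G ^ 4 / (2 * |M|) * (η' + 4 * |M| * Vp / (G * s)) =
        G ^ 4 / (2 * |M|) * η' + 2 * G ^ 3 * Vp / s := by
      field_simp; ring
    rw [e3, e4] at h
    exact h
  have hB : G ^ 4 / (2 * |M|) * η' / c ^ (3 / 4 : ℝ) = ε / 4 := by
    rw [hη']; field_simp; ring
  have hC : 2 * G ^ 3 * Vp / s / c ^ (3 / 4 : ℝ) ≤ ε / 4 := by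
    rw [div_div, div_le_iff₀ (by positivity)]
    have h1' : 8 * G ^ 3 * Vp / (ε * c ^ (3 / 4 : ℝ)) ≤ s := by
      have : 8 * G ^ 3 * Vp / (ε * c ^ (3 / 4 : ℝ)) ≤ s₀ := by rw [hs₀]; linarith
      exact this.trans hss₀
    have h2' := (div_le_iff₀ (by positivity : 0 < ε * c ^ (3 / 4 : ℝ))).mp h1'
    nlinarith [h2', hc34, hε]
  calc s ^ 3 / c ^ (3 / 4 : ℝ) * r = s ^ 3 * r / c ^ (3 / 4 : ℝ) := by ring
    _ ≤ (G ^ 4 / (2 * |M|) * η' + 2 * G ^ 3 * Vp / s) / c ^ (3 / 4 : ℝ) :=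
        div_le_div_of_nonneg_right hA hc34.le
    _ = G ^ 4 / (2 * |M|) * η' / c ^ (3 / 4 : ℝ) + 2 * G ^ 3 * Vp / s / c ^ (3 / 4 : ℝ) := by ring
    _ ≤ ε / 4 + ε / 4 := by rw [hB]; linarith [hC]
    _ < ε := by linarith

-- operator-norm instance paths on form-valued maps are slow to unify
set_option synthInstance.maxHeartbeats 200000 in
/-- `D(η + S)(x) = DS(x)` for a field of bilinear forms (Mathlib's `fderiv_const_add`, restated on
the space of forms so that `simp` finds the instance path). [folklore] -/
theorem fderiv_minkowski_add (f : E4 → E4 →L[ℝ] E4 →L[ℝ] ℝ) (x : E4) :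
    fderiv ℝ (fun y ↦ Minkowski.bilin + f y) x = fderiv ℝ f x :=
  fderiv_const_add (𝕜 := ℝ) (f := f) (x := x) Minkowski.bilin

-- operator-norm instance paths on form-valued maps are slow to unify
set_option synthInstance.maxHeartbeats 200000 in
set_option maxHeartbeats 1600000 in
/-- **The registered QS clause (`N = 1`, `a = 0`) forces RATES_E0.** The quasi-stationarity block QS
of the line `sublinear-is-free-clean-window-charges`, instantiated VERBATIM at one hole (`N = 1`:
families over `Fin 1`, background field `η + Σ_{i : Fin 1}(…)`, weight in `⨅_{i : Fin 1}`), with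
`a 0 = 0`, `M 0 ≠ 0` and the crux kinematics of that hole, implies the weighted 4-velocity rate
`t^{3/4}‖(Λ₀e₀)˙(t)‖ → 0` of `weightedRate_e0_of_quasiStationarity`. [folklore] -/
theorem weightedRate_e0_of_QS_one {γ κ V : ℝ} (M a : Fin 1 → ℝ) (Λ : Fin 1 → ℝ → lorentzGroup)
    (ξ : Fin 1 → ℝ → E3) (ha : a 0 = 0) (hM : M 0 ≠ 0)
    (hΛ : ContDiff ℝ 1 (fun s ↦ ((Λ 0 s : E4 ≃L[ℝ] E4) : E4 →L[ℝ] E4))) (hξ : ContDiff ℝ 1 (ξ 0))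
    (hγ : ∀ t, |((Λ 0 t : E4 ≃L[ℝ] E4) (E4.basisVector 0)) 0| ≤ γ) (hκ : 0 < κ ∧ κ < 1)
    (hcone : ∀ᶠ t in atTop, ‖ξ 0 t‖ ≤ κ ^ 2 * t) (hV : ∀ᶠ t in atTop, ‖deriv (ξ 0) t‖ ≤ V)
    (hQS : ∀ ρ : ℝ → ℝ, Tendsto ρ atTop atTop →
      Tendsto (fun t : ℝ ↦ ⨆ x ∈ {x : E4 | x 0 = t ∧ E4.spatialNorm x ≤ κ * t ∧
          ρ t ≤ ⨅ i, ‖E4.spatial x - ξ i t‖},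
        ENNReal.ofReal (1 + √(√((⨅ i, ‖E4.spatial x - ξ i t‖) ^ 7))) *
          ‖fderiv ℝ (fun y : E4 ↦ Minkowski.bilin + ∑ i, (boostedKerrBilin (Λ i (y 0))
            (E4.ofTimeSpace (y 0) (ξ i (y 0))) (M i) (a i) y - Minkowski.bilin)) x
            (E4.basisVector 0)‖ₑ) atTop (𝓝 0)) :
    Tendsto (fun t : ℝ ↦ t ^ (3 / 4 : ℝ) *
      ‖deriv (fun s ↦ (((Λ 0 s : lorentzGroup) : E4 ≃L[ℝ] E4) (E4.basisVector 0))) t‖)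
      atTop (𝓝 0) := by
  refine weightedRate_e0_of_quasiStationarity hM hΛ hξ hγ hκ hcone hV fun ρ hρ ↦ ?_
  have h := hQS ρ hρ
  simp only [ciInf_unique, Fin.default_eq_zero, Fin.sum_univ_one, fderiv_minkowski_add, ha] at h
  exact h

-- operator-norm instance paths on form-valued maps are slow to unify
set_option synthInstance.maxHeartbeats 200000 in
/-- **Registered sub-goal form** (worker carrier `wr_weightedRate_e0_of_quasiStationarity` of the crux
item) of `weightedRate_e0_of_quasiStationarity`: for one Schwarzschild hole the quasi-stationarity
clause forces the weighted 4-velocity rate. [folklore] -/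
theorem wr_weightedRate_e0_of_quasiStationarity : open Literature.Geometry.Lorentzian Filter Topology in ∀ {M γ κ V : ℝ} {Λ : ℝ → lorentzGroup} {ξ : ℝ → E3}, M ≠ 0 → ContDiff ℝ 1 (fun s ↦ ((Λ s : E4 ≃L[ℝ] E4) : E4 →L[ℝ] E4)) → ContDiff ℝ 1 ξ → (∀ t : ℝ, |((Λ t : E4 ≃L[ℝ] E4) (E4.basisVector 0)) 0| ≤ γ) → (0 < κ ∧ κ < 1) → (∀ᶠ t in atTop, ‖ξ t‖ ≤ κ ^ 2 * t) → (∀ᶠ t in atTop, ‖deriv ξ t‖ ≤ V) → (∀ ρ : ℝ → ℝ, Tendsto ρ atTop atTop → Tendsto (fun t : ℝ ↦ ⨆ x ∈ {x : E4 | x 0 = t ∧ E4.spatialNorm x ≤ κ * t ∧ ρ t ≤ ‖E4.spatial x - ξ t‖}, ENNReal.ofReal (1 + √(√(‖E4.spatial x - ξ t‖ ^ 7))) * ‖fderiv ℝ (fun y : E4 ↦ boostedKerrBilin (Λ (y 0)) (E4.ofTimeSpace (y 0) (ξ (y 0))) M 0 y - Minkowski.bilin) x (E4.basisVector 0)‖ₑ)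 atTop (𝓝 0)) → Tendsto (fun t : ℝ ↦ t ^ (3 / 4 : ℝ) * ‖deriv (fun s ↦ (Λ s : E4 ≃L[ℝ] E4) (E4.basisVector 0)) t‖) atTop (𝓝 0) :=
  fun hM hΛ hξ hγ hκ hcone hV hQS ↦ weightedRate_e0_of_quasiStationarity hM hΛ hξ hγ hκ hcone hV hQS

end Summit.FinalStateConjecture.FinalStateConjecture.Theorems.SublinearIsFree.WeightedRates

end
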